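import Summits.KontsevichZagierPeriods.KontsevichZagierPeriods.Theorems.HurwitzMicroSectorsNormalFormPrincipleM3EbdExistsSimplexReps

/-!
# `NormalFormPrinciple` (stmt-KontsevichZagierPeriods-3869), line `SketchIdeator1` —
# leaf `stub_boxRigidity`, layer `L2W3`: the dilation `t ↦ t²` of the decreasing simplex (rule 2)

Pure proof file (registered sub-goal `l2w3_dilation_move` of the layer `L2W3` = "level-2
weight-3 descent", lead seat c9; `--supports` the crux). The distribution relations of weight-3
polylogarithms at level `2` are, in the Kontsevich–Zagier calculus, ONE change of variables: the
dilation

  `Φ(t₀, t₁, t₂) = (t₀², t₁², t₂²)`,   `DΦ(t) = diag(2t₀, 2t₁, 2t₂)`,   `|det DΦ(t)| = 8 t₀t₁t₂`,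

of the decreasing open simplex `Δ = {0 < t₂ < t₁ < t₀ < 1} ⊆ ℝ³` onto itself (squaring is an
increasing bijection of `(0,1)`, inverse `√`; `Φ` is a `ℚ`-polynomial, hence `ℚ`-semialgebraic,
map). Pulling back a word integrand `x(t₀) y(t₁) z(t₂)` of a GIVEN representation `T` on `Δ`
along `Φ` gives `(x(s₀²)·2s₀)(y(s₁²)·2s₁)(z(s₂²)·2s₂) = T.integrand (Φ s) · |det DΦ(s)|`.

* Part (1): for every representation `N` on `Δ` carrying the pulled-back integrand,
  `[N] − [T] ∈ KZ.changeOfVariablesRel ⊆ KZ.relations` (rule (2) asks for the integrand identity on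
  the domain only, so the `EqOn` hypotheses suffice).
* Part (2): such an `N` exists. Nothing is assumed about the letters `x, y, z`: the pulled-back
  integrand is `ℚ`-semialgebraic on `Δ` as the composite of `T.integrand` with the semialgebraic
  chart (`IsSemialgebraicFunOn.comp_isSemialgebraicMapOn_holds`) times the polynomial Jacobian, and
  absolutely integrable on `Δ` by Mathlib's Jacobian criterion
  (`MeasureTheory.integrableOn_image_iff_integrableOn_abs_det_fderiv_smul`) applied to
  `T.integrableOn` on `Φ '' Δ = Δ`.

Pattern of `AlgLevelTwo.lt2_exists_squaresChart` / `levelTwo_squares` (the same chart in dimension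
two on the box) and of `M3.ebd1_exists_simplexChart` (3 × 3 chart mechanics).

References: M. Kontsevich, D. Zagier, *Periods* (2001), §1.1–1.2, rule (2). No definitions are
introduced.
-/

noncomputable section

open MeasureTheory Set
open Literature.NumberTheory.Transcendental Literature.NumberTheory.Transcendental.KZ
open Literature.ModelTheory.ExponentialFields (IsSemialgebraic)

namespace Summit.KontsevichZagierPeriods.HurwitzMicroSectors.NormalFormPrinciple.PiBox.M3

/-! ## The dilation chart of the decreasing open simplex -/

/-- On the decreasing open simplex all three coordinates are positive. [folklore] -/
theorem l2d_pos_of_mem_simplex {t : Fin 3 → ℝ}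
    (ht : t ∈ {t : Fin 3 → ℝ | 0 < t 2 ∧ t 2 < t 1 ∧ t 1 < t 0 ∧ t 0 < 1}) :
    0 < t 0 ∧ 0 < t 1 ∧ 0 < t 2 := by
  obtain ⟨h2, h21, h10, _⟩ := ht
  exact ⟨(h2.trans h21).trans h10, h2.trans h21, h2⟩

/-- **The dilation chart `Φ(t₀,t₁,t₂) = (t₀², t₁², t₂²)`** of the decreasing open simplex
`{0 < t₂ < t₁ < t₀ < 1}` onto itself: a `ℚ`-polynomial (hence `ℚ`-semialgebraic) map,
differentiable with derivative `diag(2t₀, 2t₁, 2t₂)` and `|det DΦ| = 8 t₀t₁t₂` on the simplex,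
injective on the simplex (squares of positive reals) and ONTO it (squaring is increasing on the
positive reals and preserves `(0,1)`; inverse `(√u₀, √u₁, √u₂)`). [folklore] -/
theorem l2d_exists_dilationChart :
    ∃ (Φ : (Fin 3 → ℝ) → (Fin 3 → ℝ)) (Φ' : (Fin 3 → ℝ) → (Fin 3 → ℝ) →L[ℝ] (Fin 3 → ℝ)),
      (∀ t, Φ t 0 = t 0 ^ 2) ∧ (∀ t, Φ t 1 = t 1 ^ 2) ∧ (∀ t, Φ t 2 = t 2 ^ 2) ∧
      IsSemialgebraicMapOn ℚ {t : Fin 3 → ℝ | 0 < t 2 ∧ t 2 < t 1 ∧ t 1 < t 0 ∧ t 0 < 1} Φ ∧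
      (∀ t, HasFDerivAt Φ (Φ' t) t) ∧
      Set.InjOn Φ {t : Fin 3 → ℝ | 0 < t 2 ∧ t 2 < t 1 ∧ t 1 < t 0 ∧ t 0 < 1} ∧
      Φ '' {t : Fin 3 → ℝ | 0 < t 2 ∧ t 2 < t 1 ∧ t 1 < t 0 ∧ t 0 < 1} =
        {t : Fin 3 → ℝ | 0 < t 2 ∧ t 2 < t 1 ∧ t 1 < t 0 ∧ t 0 < 1} ∧
      (∀ t ∈ {t : Fin 3 → ℝ | 0 < t 2 ∧ t 2 < t 1 ∧ t 1 < t 0 ∧ t 0 < 1},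
        |(Φ' t).det| = 8 * t 0 * t 1 * t 2) := by
  set Φ : (Fin 3 → ℝ) → (Fin 3 → ℝ) := fun t => ![t 0 ^ 2, t 1 ^ 2, t 2 ^ 2]
  set Φ' : (Fin 3 → ℝ) → (Fin 3 → ℝ) →L[ℝ] (Fin 3 → ℝ) := fun t =>
    LinearMap.toContinuousLinearMap
      (Matrix.toLin' !![2 * t 0, 0, 0; 0, 2 * t 1, 0; 0, 0, 2 * t 2])
  have hΦ0 : ∀ t, Φ t 0 = t 0 ^ 2 := fun t => rfl
  have hΦ1 : ∀ t, Φ t 1 = t 1 ^ 2 := fun t => rfl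
  have hΦ2 : ∀ t, Φ t 2 = t 2 ^ 2 := fun t => rfl
  have hΦ'0 : ∀ t v : Fin 3 → ℝ, Φ' t v 0 = 2 * t 0 * v 0 := by
    intro t v
    change Matrix.toLin' !![2 * t 0, 0, 0; 0, 2 * t 1, 0; 0, 0, 2 * t 2] v 0 = _
    rw [Matrix.toLin'_apply]
    simp [Matrix.mulVec, dotProduct, Fin.sum_univ_three]
  have hΦ'1 : ∀ t v : Fin 3 → ℝ, Φ' t v 1 = 2 * t 1 * v 1 := by
    intro t v
    change Matrix.toLin' !![2 * t 0, 0, 0; 0, 2 * t 1, 0; 0, 0, 2 * t 2] v 1 = _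
    rw [Matrix.toLin'_apply]
    simp [Matrix.mulVec, dotProduct, Fin.sum_univ_three]
  have hΦ'2 : ∀ t v : Fin 3 → ℝ, Φ' t v 2 = 2 * t 2 * v 2 := by
    intro t v
    change Matrix.toLin' !![2 * t 0, 0, 0; 0, 2 * t 1, 0; 0, 0, 2 * t 2] v 2 = _
    rw [Matrix.toLin'_apply]
    simp [Matrix.mulVec, dotProduct, Fin.sum_univ_three]
  have hdet : ∀ t, (Φ' t).det = 8 * t 0 * t 1 * t 2 := by
    intro t
    change LinearMap.det
      (Matrix.toLin' !![2 * t 0, 0, 0; 0, 2 * t 1, 0; 0, 0, 2 * t 2]) = _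
    rw [LinearMap.det_toLin', Matrix.det_fin_three]
    simp only [Matrix.of_apply, Matrix.cons_val', Matrix.cons_val_zero, Matrix.cons_val_one,
      Matrix.cons_val_two, Matrix.empty_val', Matrix.cons_val_fin_one, Matrix.head_cons,
      Matrix.tail_cons, Matrix.head_fin_const]
    ring
  have hderiv : ∀ t, HasFDerivAt Φ (Φ' t) t := by
    intro t
    have h0 : HasFDerivAt (fun s : Fin 3 → ℝ => s 0)
        (ContinuousLinearMap.proj (R := ℝ) (φ := fun _ : Fin 3 => ℝ) 0) t := hasFDerivAt_apply 0 t
    have h1 : HasFDerivAt (fun s : Fin 3 → ℝ => s 1)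
        (ContinuousLinearMap.proj (R := ℝ) (φ := fun _ : Fin 3 => ℝ) 1) t := hasFDerivAt_apply 1 t
    have h2 : HasFDerivAt (fun s : Fin 3 → ℝ => s 2)
        (ContinuousLinearMap.proj (R := ℝ) (φ := fun _ : Fin 3 => ℝ) 2) t := hasFDerivAt_apply 2 t
    have e0 : (fun s : Fin 3 → ℝ => s 0 ^ 2) = fun s => s 0 * s 0 := funext fun s => sq (s 0)
    have e1 : (fun s : Fin 3 → ℝ => s 1 ^ 2) = fun s => s 1 * s 1 := funext fun s => sq (s 1)
    have e2 : (fun s : Fin 3 → ℝ => s 2 ^ 2) = fun s => s 2 * s 2 := funext fun s => sq (s 2)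
    rw [hasFDerivAt_pi']
    refine Fin.forall_fin_succ.2 ⟨?_, Fin.forall_fin_two.2 ⟨?_, ?_⟩⟩
    · show HasFDerivAt (fun s : Fin 3 → ℝ => s 0 ^ 2) _ t
      rw [e0]
      refine (h0.mul h0).congr_fderiv (ContinuousLinearMap.ext fun v => ?_)
      show t 0 * v 0 + t 0 * v 0 = Φ' t v 0
      rw [hΦ'0]
      ring
    · show HasFDerivAt (fun s : Fin 3 → ℝ => s 1 ^ 2) _ t
      rw [e1]
      refine (h1.mul h1).congr_fderiv (ContinuousLinearMap.ext fun v => ?_)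
      show t 1 * v 1 + t 1 * v 1 = Φ' t v 1
      rw [hΦ'1]
      ring
    · show HasFDerivAt (fun s : Fin 3 → ℝ => s 2 ^ 2) _ t
      rw [e2]
      refine (h2.mul h2).congr_fderiv (ContinuousLinearMap.ext fun v => ?_)
      show t 2 * v 2 + t 2 * v 2 = Φ' t v 2
      rw [hΦ'2]
      ring
  refine ⟨Φ, Φ', hΦ0, hΦ1, hΦ2, ?_, hderiv, ?_, ?_, fun t ht => ?_⟩
  · -- a `ℚ`-polynomial map is `ℚ`-semialgebraic
    convert isSemialgebraicMapOn_aeval ebd2_isSemialgebraic_simplex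
      ![(MvPolynomial.X 0 ^ 2 : MvPolynomial (Fin 3) ℚ), MvPolynomial.X 1 ^ 2,
        MvPolynomial.X 2 ^ 2] using 2 with t
    funext i
    fin_cases i
    · simp [hΦ0]
    · simp [hΦ1]
    · simp [hΦ2]
  · -- injective on the simplex (squares of positive reals)
    intro t ht s hs hts
    obtain ⟨ht0, ht1, ht2⟩ := l2d_pos_of_mem_simplex ht
    obtain ⟨hs0, hs1, hs2⟩ := l2d_pos_of_mem_simplex hs
    have e0 : t 0 ^ 2 = s 0 ^ 2 := by rw [← hΦ0, ← hΦ0, hts]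
    have e1 : t 1 ^ 2 = s 1 ^ 2 := by rw [← hΦ1, ← hΦ1, hts]
    have e2 : t 2 ^ 2 = s 2 ^ 2 := by rw [← hΦ2, ← hΦ2, hts]
    funext i
    fin_cases i
    · exact (pow_left_inj₀ ht0.le hs0.le two_ne_zero).1 e0
    · exact (pow_left_inj₀ ht1.le hs1.le two_ne_zero).1 e1
    · exact (pow_left_inj₀ ht2.le hs2.le two_ne_zero).1 e2
  · -- onto the simplex
    ext u
    constructor
    · rintro ⟨t, ht, rfl⟩
      obtain ⟨h2, h21, h10, h0⟩ := ht
      have ht1 : 0 < t 1 := h2.trans h21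
      have ht0 : 0 < t 0 := ht1.trans h10
      refine ⟨?_, ?_, ?_, ?_⟩
      · show 0 < t 2 ^ 2
        exact pow_pos h2 2
      · show t 2 ^ 2 < t 1 ^ 2
        exact pow_lt_pow_left₀ h21 h2.le two_ne_zero
      · show t 1 ^ 2 < t 0 ^ 2
        exact pow_lt_pow_left₀ h10 ht1.le two_ne_zero
      · show t 0 ^ 2 < 1
        exact pow_lt_one₀ ht0.le h0 two_ne_zero
    · rintro ⟨h2, h21, h10, h0⟩
      have hu1 : 0 < u 1 := h2.trans h21
      have hu0 : 0 < u 0 := hu1.trans h10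
      refine ⟨![Real.sqrt (u 0), Real.sqrt (u 1), Real.sqrt (u 2)], ⟨?_, ?_, ?_, ?_⟩, ?_⟩
      · show 0 < Real.sqrt (u 2)
        exact Real.sqrt_pos.2 h2
      · show Real.sqrt (u 2) < Real.sqrt (u 1)
        exact Real.sqrt_lt_sqrt h2.le h21
      · show Real.sqrt (u 1) < Real.sqrt (u 0)
        exact Real.sqrt_lt_sqrt hu1.le h10
      · show Real.sqrt (u 0) < 1
        have h := Real.sqrt_lt_sqrt hu0.le h0
        rwa [Real.sqrt_one] at h
      · funext i
        fin_cases i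
        · show Real.sqrt (u 0) ^ 2 = u 0
          exact Real.sq_sqrt hu0.le
        · show Real.sqrt (u 1) ^ 2 = u 1
          exact Real.sq_sqrt hu1.le
        · show Real.sqrt (u 2) ^ 2 = u 2
          exact Real.sq_sqrt h2.le
  · -- the Jacobian
    obtain ⟨ht0, ht1, ht2⟩ := l2d_pos_of_mem_simplex ht
    rw [hdet, abs_of_pos (mul_pos (mul_pos (mul_pos (by norm_num) ht0) ht1) ht2)]

/-! ## The registered sub-goal -/

/-- **Stub L2 (`l2w3_dilation_move`; registered sub-goal of stmt-KontsevichZagierPeriods-3869,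
line `SketchIdeator1`, layer `L2W3`).** The dilation `t ↦ (t₀², t₁², t₂²)` of the decreasing open
simplex `Δ = {0 < t₂ < t₁ < t₀ < 1}` onto itself (rule 2, Jacobian `8 s₀s₁s₂`) applied to a word
representation `T = [Δ, x(t₀) y(t₁) z(t₂)]`: (1) for every representation `N` on `Δ` whose
integrand is the pull-back `(x(s₀²)·2s₀)(y(s₁²)·2s₁)(z(s₂²)·2s₂)` there, `[N] − [T]` is ONE
change-of-variables move `KZ.changeOfVariablesRel` along `l2d_exists_dilationChart` (source `N`,
image `T`); (2) such an `N` exists — its integrand is `ℚ`-semialgebraic on `Δ` (composite of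
`T.integrand` with the semialgebraic chart, times the polynomial Jacobian) and absolutely integrable
on `Δ` (Jacobian criterion applied to `T.integrableOn` on `Φ '' Δ = Δ`).
[cite: KontsevichZagier2001, §1.2 rule (2)] -/
theorem l2w3_dilation_move :
    ∀ (x y z : ℝ → ℝ) (T : IntegralRep 3),
      T.domain = {t | 0 < t 2 ∧ t 2 < t 1 ∧ t 1 < t 0 ∧ t 0 < 1} →
      EqOn T.integrand (fun t => x (t 0) * y (t 1) * z (t 2)) T.domain →
      (∀ N : IntegralRep 3, N.domain = {t | 0 < t 2 ∧ t 2 < t 1 ∧ t 1 < t 0 ∧ t 0 < 1} →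
        EqOn N.integrand (fun s => (x (s 0 ^ 2) * (2 * s 0)) * (y (s 1 ^ 2) * (2 * s 1)) *
          (z (s 2 ^ 2) * (2 * s 2))) N.domain →
        of N - of T ∈ relations) ∧
      (∃ N : IntegralRep 3, N.domain = {t | 0 < t 2 ∧ t 2 < t 1 ∧ t 1 < t 0 ∧ t 0 < 1} ∧
        N.integrand = fun s => (x (s 0 ^ 2) * (2 * s 0)) * (y (s 1 ^ 2) * (2 * s 1)) *
          (z (s 2 ^ 2) * (2 * s 2))) := by
  intro x y z T hTd hTi
  obtain ⟨Φ, Φ', hΦ0, hΦ1, hΦ2, hsa, hderiv, hinj, himage, hdet⟩ := l2d_exists_dilationChart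
  -- the chart data transported to `T.domain = Δ`
  have hsaT : IsSemialgebraicMapOn ℚ T.domain Φ := by rw [hTd]; exact hsa
  have hinjT : InjOn Φ T.domain := by rw [hTd]; exact hinj
  have himageT : Φ '' T.domain = T.domain := by rw [hTd]; exact himage
  have hmeasT : MeasurableSet T.domain := by rw [hTd]; exact ebd2_measurableSet_simplex
  have hdetT : ∀ t ∈ T.domain, |(Φ' t).det| = 8 * t 0 * t 1 * t 2 := by rw [hTd]; exact hdet
  have hmaps : MapsTo Φ T.domain T.domain := fun t ht => himageT ▸ mem_image_of_mem Φ ht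
  -- the pull-back identity on `Δ`, Jacobian `|det DΦ| = 8 s₀s₁s₂` included
  have hpull : ∀ s ∈ T.domain, T.integrand (Φ s) * |(Φ' s).det| =
      (x (s 0 ^ 2) * (2 * s 0)) * (y (s 1 ^ 2) * (2 * s 1)) * (z (s 2 ^ 2) * (2 * s 2)) := by
    intro s hs
    rw [hTi (hmaps hs), hdetT s hs]
    simp only [hΦ0, hΦ1, hΦ2]
    ring
  refine ⟨fun N hNd hNi => ?_, ?_⟩
  · -- (1) one change-of-variables move, source `N`, image `T`
    have hNT : N.domain = T.domain := hNd.trans hTd.symm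
    have himage' : T.domain = Φ '' N.domain := by rw [hNT, himageT]
    have hsaN : IsSemialgebraicMapOn ℚ N.domain Φ := by rw [hNT]; exact hsaT
    have hinjN : InjOn Φ N.domain := by rw [hNT]; exact hinjT
    refine changeOfVariablesRel_subset_relations
      ⟨3, N, T, Φ, Φ', hsaN, fun s _ => (hderiv s).hasFDerivWithinAt, hinjN, himage',
        fun s hs => ?_, rfl⟩
    rw [hNi hs, hpull s (hNT ▸ hs)]
  · -- (2) existence of the pulled-back representation on `Δ`
    have hcomp : IsSemialgebraicFunOn ℚ T.domain (T.integrand ∘ Φ) :=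
      IsSemialgebraicFunOn.comp_isSemialgebraicMapOn_holds T.isSemialgebraicFunOn_integrand hsaT
        hmaps
    have hjac : IsSemialgebraicFunOn ℚ T.domain (fun s => |(Φ' s).det|) := by
      refine (isSemialgebraicFunOn_aeval T.isSemialgebraic_domain
        ((8 : MvPolynomial (Fin 3) ℚ) * MvPolynomial.X 0 * MvPolynomial.X 1 *
          MvPolynomial.X 2)).congr fun s hs => ?_
      rw [hdetT s hs]
      simp only [map_mul, map_ofNat, MvPolynomial.aeval_X]
    have hsaN : IsSemialgebraicFunOn ℚ T.domain (fun s => (x (s 0 ^ 2) * (2 * s 0)) *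
        (y (s 1 ^ 2) * (2 * s 1)) * (z (s 2 ^ 2) * (2 * s 2))) :=
      (IsSemialgebraicFunOn.mul_holds hcomp hjac).congr fun s hs => hpull s hs
    have hint : IntegrableOn (fun s => (x (s 0 ^ 2) * (2 * s 0)) *
        (y (s 1 ^ 2) * (2 * s 1)) * (z (s 2 ^ 2) * (2 * s 2))) T.domain := by
      have h1 : IntegrableOn T.integrand (Φ '' T.domain) := by rw [himageT]; exact T.integrableOn
      rw [integrableOn_image_iff_integrableOn_abs_det_fderiv_smul volume hmeasT
        (fun s _ => (hderiv s).hasFDerivWithinAt) hinjT] at h1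
      refine h1.congr_fun (fun s hs => ?_) hmeasT
      show |(Φ' s).det| * T.integrand (Φ s) = _
      rw [mul_comm]
      exact hpull s hs
    exact ⟨⟨T.domain, _, T.isSemialgebraic_domain, hsaN, hint⟩, hTd, rfl⟩

end Summit.KontsevichZagierPeriods.HurwitzMicroSectors.NormalFormPrinciple.PiBox.M3
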